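import Literature.Analysis.FluidPDE.ElgindiHkClosure
import Mathlib.Analysis.MeanInequalities
import HarnessLib

/-!
# The triangle inequality for the `𝓗ᵏ` norm and continuity of the functional along approximating sequences
([Elgindi2021] §1.7.2: `|·|_{𝓗ᵏ}` is a norm)

Topic `Literature/Analysis/FluidPDE`. Support file (definitions with bodies and proved theorems, no
named facts) on the proof path of the named fact
`Literature.Analysis.FluidPDE.Elgindi.ElgindiGhoulMasmoudi2021_stabilityCore`
(`ElgindiStabilityDecomposition.lean`). T. M. Elgindi, Ann. of Math. 194 (2021) =
arXiv:1904.04795, §1.7.2 (p. 7): the `𝓗ᵏ` norm is an `ℓ²`-sum of weighted `L²` norms of words.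

`|f + g|_{𝓗ᵏ} ≤ |f|_{𝓗ᵏ} + |g|_{𝓗ᵏ}` for `f, g ∈ Cᵏ(strip)` (`eHkNormSq_sqrt_add_le`: Minkowski in
`L²(strip)` for each weighted word, then Minkowski in `ℓ²` over the words), and consequently
`|f_n|²_{𝓗⁴} → |F|²_{𝓗⁴}` along an `𝓗⁴`-approximating sequence (`HkApprox.tendsto_eHkNormSq`).
-/

noncomputable section

open MeasureTheory Set Function Real Filter Finset
open _root_.Topology
open scoped ENNReal ContDiff

namespace Literature.Analysis.FluidPDE

namespace Elgindi

/-! ### `ℓ²`-Minkowski for square-root-subadditive finite sums -/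

/-- `(x^{1/2})² = x` in `ℝ≥0∞`. [folklore] -/
theorem ennreal_sqrt_sq (x : ℝ≥0∞) : (x ^ (1 / 2 : ℝ)) ^ (2 : ℝ) = x := by
  rw [← ENNReal.rpow_mul]; norm_num

/-- `(x²)^{1/2} = x` in `ℝ≥0∞` (real exponent). [folklore] -/
theorem ennreal_sq_sqrt (x : ℝ≥0∞) : (x ^ (2 : ℝ)) ^ (1 / 2 : ℝ) = x := by
  rw [← ENNReal.rpow_mul]; norm_num

/-- **`ℓ²`-Minkowski for square-root-subadditive summands**: if `c_t^{1/2} ≤ a_t^{1/2} + b_t^{1/2}`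
for `t ∈ s`, then `(Σc)^{1/2} ≤ (Σa)^{1/2} + (Σb)^{1/2}`. [folklore] -/
theorem sqrt_sum_le_of_sqrt_le {ι : Type*} (s : Finset ι) {a b c : ι → ℝ≥0∞}
    (h : ∀ t ∈ s, c t ^ (1 / 2 : ℝ) ≤ a t ^ (1 / 2 : ℝ) + b t ^ (1 / 2 : ℝ)) :
    (∑ t ∈ s, c t) ^ (1 / 2 : ℝ) ≤ (∑ t ∈ s, a t) ^ (1 / 2 : ℝ) + (∑ t ∈ s, b t) ^ (1 / 2 : ℝ) := by
  have h1 : ∑ t ∈ s, c t ≤ ∑ t ∈ s, (a t ^ (1 / 2 : ℝ) + b t ^ (1 / 2 : ℝ)) ^ (2 : ℝ) := by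
    refine sum_le_sum fun t ht => ?_
    calc c t = (c t ^ (1 / 2 : ℝ)) ^ (2 : ℝ) := (ennreal_sqrt_sq _).symm
      _ ≤ (a t ^ (1 / 2 : ℝ) + b t ^ (1 / 2 : ℝ)) ^ (2 : ℝ) := ENNReal.rpow_le_rpow (h t ht) (by norm_num)
  have h2 := ENNReal.Lp_add_le (fun t => a t ^ (1 / 2 : ℝ)) (fun t => b t ^ (1 / 2 : ℝ)) (s := s) (p := 2) one_le_two
  simp only [ennreal_sqrt_sq] at h2
  exact (ENNReal.rpow_le_rpow h1 (by norm_num)).trans h2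

/-- The two-summand case. [folklore] -/
theorem sqrt_add_le_of_sqrt_le {a₁ b₁ c₁ a₂ b₂ c₂ : ℝ≥0∞} (h₁ : c₁ ^ (1 / 2 : ℝ) ≤ a₁ ^ (1 / 2 : ℝ) + b₁ ^ (1 / 2 : ℝ))
    (h₂ : c₂ ^ (1 / 2 : ℝ) ≤ a₂ ^ (1 / 2 : ℝ) + b₂ ^ (1 / 2 : ℝ)) :
    (c₁ + c₂) ^ (1 / 2 : ℝ) ≤ (a₁ + a₂) ^ (1 / 2 : ℝ) + (b₁ + b₂) ^ (1 / 2 : ℝ) := by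
  have := sqrt_sum_le_of_sqrt_le (univ : Finset (Fin 2)) (a := ![a₁, a₂]) (b := ![b₁, b₂]) (c := ![c₁, c₂]) fun t _ => by
    fin_cases t
    · exact h₁
    · exact h₂
  simpa [Fin.sum_univ_two] using this

/-! ### Minkowski for the weighted words -/

/-- `∫∫_strip ‖h‖² = ‖h‖²_{L²(strip)}` (real exponent form). [folklore] -/
theorem lintegral_enorm_sq_eq_eLpNorm_rpow (h : ℝ × ℝ → ℝ) :
    ∫⁻ p in strip, ‖h p‖ₑ ^ 2 = (eLpNorm h 2 (volume.restrict strip)) ^ (2 : ℝ) := by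
  rw [eLpNorm_eq_lintegral_rpow_enorm_toReal two_ne_zero ENNReal.ofNat_ne_top]
  simp only [ENNReal.toReal_ofNat, one_div]
  rw [← ENNReal.rpow_mul]
  norm_num

/-- **Minkowski for one weighted word on the strip**: for `f, g ∈ Cᵏ(strip)`, `i + j ≤ k` and a
weight `wf` continuous on the strip,
`‖D^{ij}(f+g)ω‖_{L²} ≤ ‖D^{ij}f ω‖_{L²} + ‖D^{ij}g ω‖_{L²}`. [folklore] -/
theorem sqrt_eL2Sq_word_add_le {k : ℕ} {f g : ℝ → ℝ → ℝ} (hf : ContDiffOn ℝ k (uncurry f) strip) (hg : ContDiffOn ℝ k (uncurry g) strip)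
    {i j : ℕ} (hij : i + j ≤ k) {wf : ℝ → ℝ → ℝ} (hω : ContinuousOn (uncurry wf) strip) :
    (eL2Sq fun z θ => (Dθ^[i] (Dz^[j] (f + g))) z θ * wf z θ) ^ (1 / 2 : ℝ) ≤
      (eL2Sq fun z θ => (Dθ^[i] (Dz^[j] f)) z θ * wf z θ) ^ (1 / 2 : ℝ) + (eL2Sq fun z θ => (Dθ^[i] (Dz^[j] g)) z θ * wf z θ) ^ (1 / 2 : ℝ) := by
  set a : ℝ × ℝ → ℝ := fun p => (Dθ^[i] (Dz^[j] f)) p.1 p.2 * wf p.1 p.2 with ha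
  set b : ℝ × ℝ → ℝ := fun p => (Dθ^[i] (Dz^[j] g)) p.1 p.2 * wf p.1 p.2 with hb
  have ma : AEStronglyMeasurable a (volume.restrict strip) :=
    ((continuousOn_iterate_Dθ_Dz hf hij).mul hω).aestronglyMeasurable measurableSet_strip
  have mb : AEStronglyMeasurable b (volume.restrict strip) :=
    ((continuousOn_iterate_Dθ_Dz hg hij).mul hω).aestronglyMeasurable measurableSet_strip
  have esum : eL2Sq (fun z θ => (Dθ^[i] (Dz^[j] (f + g))) z θ * wf z θ) = ∫⁻ p in strip, ‖(a + b) p‖ₑ ^ 2 := by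
    unfold eL2Sq
    refine setLIntegral_congr_fun measurableSet_strip fun p hp => ?_
    show ‖(Dθ^[i] (Dz^[j] (f + g))) p.1 p.2 * wf p.1 p.2‖ₑ ^ 2 = ‖(a + b) p‖ₑ ^ 2
    rw [iterate_Dθ_Dz_add hf hg hij p hp, Pi.add_apply, ha, hb, add_mul]
  have ea : eL2Sq (fun z θ => (Dθ^[i] (Dz^[j] f)) z θ * wf z θ) = ∫⁻ p in strip, ‖a p‖ₑ ^ 2 := rfl
  have eb : eL2Sq (fun z θ => (Dθ^[i] (Dz^[j] g)) z θ * wf z θ) = ∫⁻ p in strip, ‖b p‖ₑ ^ 2 := rfl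
  rw [esum, ea, eb, lintegral_enorm_sq_eq_eLpNorm_rpow, lintegral_enorm_sq_eq_eLpNorm_rpow, lintegral_enorm_sq_eq_eLpNorm_rpow,
    ennreal_sq_sqrt, ennreal_sq_sqrt, ennreal_sq_sqrt]
  exact eLpNorm_add_le ma mb one_le_two

/-- **The triangle inequality for the `𝓗ᵏ` norm**: `|f + g|_{𝓗ᵏ} ≤ |f|_{𝓗ᵏ} + |g|_{𝓗ᵏ}` for
`f, g ∈ Cᵏ` of the open strip. [cite: Elgindi2021, §1.7.2 (p. 7 of arXiv:1904.04795)] -/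
theorem eHkNormSq_sqrt_add_le {α : ℝ} {k : ℕ} {f g : ℝ → ℝ → ℝ} (hf : ContDiffOn ℝ k (uncurry f) strip)
    (hg : ContDiffOn ℝ k (uncurry g) strip) :
    (eHkNormSq α k (f + g)) ^ (1 / 2 : ℝ) ≤ (eHkNormSq α k f) ^ (1 / 2 : ℝ) + (eHkNormSq α k g) ^ (1 / 2 : ℝ) := by
  have hωr : ContinuousOn (uncurry hWeight) strip := continuousOn_hWeight
  have hωm : ContinuousOn (uncurry (totalWeight α)) strip := by
    refine (continuousOn_wordWeight α 1).congr fun p _ => ?_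
    show totalWeight α p.1 p.2 = wordWeight α 1 p.1 p.2
    simp [wordWeight]
  unfold eHkNormSq
  refine sqrt_add_le_of_sqrt_le (sqrt_sum_le_of_sqrt_le _ fun j hj => ?_) (sqrt_sum_le_of_sqrt_le _ fun i _ => sqrt_sum_le_of_sqrt_le _ fun j _ => ?_)
  · have hj' : 0 + j ≤ k := by have := mem_range.1 hj; omega
    exact sqrt_eL2Sq_word_add_le hf hg hj' hωr
  · split_ifs with hc
    · exact sqrt_eL2Sq_word_add_le hf hg hc.2 hωm
    · simp

/-- The triangle inequality for differences: `|f|_{𝓗ᵏ} ≤ |g|_{𝓗ᵏ} + |f − g|_{𝓗ᵏ}`. [folklore] -/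
theorem eHkNormSq_sqrt_le_add_sub {α : ℝ} {k : ℕ} {f g : ℝ → ℝ → ℝ} (hf : ContDiffOn ℝ k (uncurry f) strip)
    (hg : ContDiffOn ℝ k (uncurry g) strip) :
    (eHkNormSq α k f) ^ (1 / 2 : ℝ) ≤ (eHkNormSq α k g) ^ (1 / 2 : ℝ) + (eHkNormSq α k (f - g)) ^ (1 / 2 : ℝ) := by
  have e : f = g + (f - g) := by funext z θ; simp
  have hfg : ContDiffOn ℝ k (uncurry (f - g)) strip := (hf.sub hg).congr fun _ _ => rfl
  conv_lhs => rw [e]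
  exact eHkNormSq_sqrt_add_le hg hfg

/-! ### Continuity of the functional along approximating sequences -/

/-- **`|f_n|²_{𝓗⁴} → |F|²_{𝓗⁴}`** along an `𝓗⁴`-approximating sequence. [folklore] -/
theorem HkApprox.tendsto_eHkNormSq {α : ℝ} {F : ℝ → ℝ → ℝ} {fs : ℕ → ℝ → ℝ → ℝ} (hA : HkApprox α F fs) :
    Tendsto (fun n => eHkNormSq α 4 (fs n)) atTop (𝓝 (eHkNormSq α 4 F)) := by
  have hF4 : ContDiffOn ℝ 4 (uncurry F) strip :=
    hA.smooth.of_le (WithTop.coe_le_coe.2 le_top : (4 : WithTop ℕ∞) ≤ ((⊤ : ℕ∞) : WithTop ℕ∞))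
  have hf4 : ∀ n, ContDiffOn ℝ 4 (uncurry (fs n)) strip := fun n => ((hA.test n).smooth 4).contDiffOn
  set ε : ℕ → ℝ≥0∞ := fun n => (eHkNormSq α 4 (fs n - F)) ^ (1 / 2 : ℝ) with hε
  have hε0 : Tendsto ε atTop (𝓝 0) := by
    have := ((ENNReal.continuous_rpow_const (y := (1 / 2 : ℝ))).tendsto (0:ℝ≥0∞)).comp hA.conv
    rwa [ENNReal.zero_rpow_of_pos (by norm_num : (0:ℝ) < 1 / 2)] at this
  have hsymm : ∀ n, eHkNormSq α 4 (F - fs n) = eHkNormSq α 4 (fs n - F) := fun n => by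
    have e' : F - fs n = (-1 : ℝ) • (fs n - F) := by funext z θ; simp
    rw [e', eHkNormSq_smul, Real.enorm_eq_ofReal_abs, abs_neg, abs_one, ENNReal.ofReal_one, one_pow, one_mul]
  -- two-sided bounds for the square roots
  have h1 : ∀ n, (eHkNormSq α 4 (fs n)) ^ (1 / 2 : ℝ) ≤ (eHkNormSq α 4 F) ^ (1 / 2 : ℝ) + ε n :=
    fun n => eHkNormSq_sqrt_le_add_sub (hf4 n) hF4
  have h2 : ∀ n, (eHkNormSq α 4 F) ^ (1 / 2 : ℝ) ≤ (eHkNormSq α 4 (fs n)) ^ (1 / 2 : ℝ) + ε n := fun n => by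
    have := eHkNormSq_sqrt_le_add_sub (α := α) hF4 (hf4 n)
    rwa [hsymm n] at this
  have hfin : (eHkNormSq α 4 F) ^ (1 / 2 : ℝ) ≠ ⊤ := ENNReal.rpow_ne_top_of_nonneg (by norm_num) hA.eHkNormSq_lt_top.ne
  have hroot : Tendsto (fun n => (eHkNormSq α 4 (fs n)) ^ (1 / 2 : ℝ)) atTop (𝓝 ((eHkNormSq α 4 F) ^ (1 / 2 : ℝ))) := by
    have hlow : Tendsto (fun n => (eHkNormSq α 4 F) ^ (1 / 2 : ℝ) - ε n) atTop (𝓝 ((eHkNormSq α 4 F) ^ (1 / 2 : ℝ))) := by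
      have := ENNReal.Tendsto.sub (tendsto_const_nhds (x := (eHkNormSq α 4 F) ^ (1 / 2 : ℝ))) hε0 (Or.inl hfin)
      rwa [tsub_zero] at this
    have hup : Tendsto (fun n => (eHkNormSq α 4 F) ^ (1 / 2 : ℝ) + ε n) atTop (𝓝 ((eHkNormSq α 4 F) ^ (1 / 2 : ℝ))) := by
      have := (tendsto_const_nhds (x := (eHkNormSq α 4 F) ^ (1 / 2 : ℝ))).add hε0
      rwa [add_zero] at this
    exact tendsto_of_tendsto_of_tendsto_of_le_of_le hlow hup (fun n => tsub_le_iff_right.2 (h2 n)) h1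
  -- square
  have hsq := ((ENNReal.continuous_rpow_const (y := (2 : ℝ))).tendsto _).comp hroot
  simp only [Function.comp_def, ennreal_sqrt_sq] at hsq
  exact hsq

end Elgindi

end Literature.Analysis.FluidPDE
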